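import Mathlib
import Summits.Ventures.DiscreteObjects.Mahler.CensusResultantCuts

/-!
# Explicit-auxiliary-function power-sum cuts: the abstract inequality (venture `DiscreteObjects`, target L)

Cell `pub-namedobj`, seat `pub-namedobj-mahler-g14`. Framing: lottery ticket; floor = certified bounds/negative
ranges.

The method of explicit auxiliary functions (Smyth; Flammang–Rhin–Sac-Épée, Math. Comp. 75 (2006) §3–5; Mossinghoff–
Rhin–Wu 2008) in the form used by the kernel census.  Data: an integer functional `a = (a_1,…,a_K)` on the power sums,
integer vectors `v_j` (polynomials `Q_j(z) = Σ_i v_{j,i} z^i`, `q̂_j(z) := Q_j(z)Q_j(z⁻¹)`) with rational weights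
`e_j ≥ 0`, and constants `m₀`, `c ≥ 0`.  The AUXILIARY FUNCTION is

  `F(z) = Σ_k a_k · Re(z^k + z^{-k})/2 - Σ_j e_j · log ‖q̂_j(z)‖`

(on the unit circle: `Σ a_k cos kθ - Σ e_j log |Q_j(e^{iθ})|²`).  HYPOTHESIS (H) (`AuxBound`, to be certified separately
by rational interval arithmetic): `F(z) ≥ -m₀ - c·√(‖z‖ + ‖z‖⁻¹ - 2)` for `1 ≤ ‖z‖ ≤ B` off the zeros of the `q̂_j`
(the slack `√(r + 1/r - 2) = √r - 1/√r = 2 sinh(½ log r)` is superadditive in `log r`, so it sums to at most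
`√B - 1/√B` over the roots; it is algebraic in `u = r + 1/r`, which keeps the certificates rational).
CONCLUSION (`auxCut_halfRoots`): for a reciprocal root configuration `s` (`d = |s|`, `M ≤ B`) with
`1 ≤ ∏_{α∈s} ‖q̂_j(α)‖` for every `j` (a nonzero resultant — automatic for irreducible `P` of degree `> deg Q_j`,
`one_le_prod_norm_vEval_halfRoots`):

  `Σ_k a_k · Re s_k ≥ -2d·m₀ - 2c·(√B - 1/√B)`.

Proof: `F(α) = F(α⁻¹)`, so (H) applies at whichever of `α, α⁻¹` has norm `R_α = max(‖α‖,‖α‖⁻¹) ∈ [1, M] ⊆ [1, B]`;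
summing, `Σ_α F(α) ≥ -d m₀ - c Σ_α (√R_α - 1/√R_α) ≥ -d m₀ - c (√M - 1/√M)` (superadditivity), while `Σ_α F(α) = ½ Σ_k a_k Re s_k - Σ_j e_j log ∏_α ‖q̂_j(α)‖
≤ ½ Σ_k a_k Re s_k`.  `acut_holds` is the integer form `0 ≤ N + Σ_k a_k P_k` (`2d m₀ + 2c (√B - 1/√B) < N + 1`) for irreducible
`p`, in the table format of `censusSearchC` (`CutValidA`).  With LP-optimal cyclotomic `Q_j` this gives e.g. `|P₁| ≤ 3` at
degree 18, `B = 13/10` (box: 18; resultant cut: 9) — sizing in the seat's HANDOFF; the certification of (H) is NOT in this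
file.
-/

namespace Summit.Ventures.DiscreteObjects.Mahler

open Polynomial

/-! ## The auxiliary function -/

/-- `q̂_v(z) = Q_v(z)·Q_v(z⁻¹)` for an integer vector `v`. -/
noncomputable def qhat (v : List ℤ) (z : ℂ) : ℂ :=
  vEval (v.map (Int.cast : ℤ → ℝ)) z * vEval (v.map (Int.cast : ℤ → ℝ)) z⁻¹

/-- The auxiliary function `F(z) = Σ_{k<|a|} a_k Re(z^{k+1} + z^{-(k+1)})/2 - Σ_j e_j log ‖q̂_j(z)‖`. -/
noncomputable def auxF (a : List ℤ) (qs : List (List ℤ × ℚ)) (z : ℂ) : ℝ :=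
  ∑ k ∈ Finset.range a.length, ((a.getD k 0 : ℤ) : ℝ) * ((z ^ (k + 1) + z⁻¹ ^ (k + 1)).re / 2) -
    ∑ j ∈ Finset.range qs.length, (((qs.getD j ([], 0)).2 : ℚ) : ℝ) * Real.log ‖qhat (qs.getD j ([], 0)).1 z‖

/-- HYPOTHESIS (H): `F(z) ≥ -m₀ - c √(‖z‖ + ‖z‖⁻¹ - 2)` on the annulus `1 ≤ ‖z‖ ≤ B`, off the zeros of the `q̂_j`. -/
def AuxBound (a : List ℤ) (qs : List (List ℤ × ℚ)) (B m₀ c : ℝ) : Prop :=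
  ∀ z : ℂ, 1 ≤ ‖z‖ → ‖z‖ ≤ B → (∀ j < qs.length, qhat (qs.getD j ([], 0)).1 z ≠ 0) →
    -m₀ - c * Real.sqrt (‖z‖ + ‖z‖⁻¹ - 2) ≤ auxF a qs z

/-! ## Symmetry and elementary facts -/

/-- `q̂(z⁻¹) = q̂(z)`. -/
theorem qhat_inv (v : List ℤ) (z : ℂ) : qhat v z⁻¹ = qhat v z := by
  unfold qhat; rw [inv_inv, mul_comm]

/-- `F(z⁻¹) = F(z)`. -/
theorem auxF_inv (a : List ℤ) (qs : List (List ℤ × ℚ)) (z : ℂ) : auxF a qs z⁻¹ = auxF a qs z := by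
  unfold auxF
  simp only [inv_inv, qhat_inv]
  congr 1
  apply Finset.sum_congr rfl
  intro k _
  rw [add_comm (z⁻¹ ^ (k + 1))]

/-- `log` of a product of positive reals (multiset form). -/
theorem log_multiset_prod_eq_sum (u : Multiset ℝ) (hu : ∀ x ∈ u, 0 < x) :
    Real.log u.prod = (u.map Real.log).sum := by
  induction u using Multiset.induction_on with
  | empty => simp
  | cons x u ih =>
    have hx : 0 < x := hu x (Multiset.mem_cons_self x u)
    have hu' : ∀ y ∈ u, 0 < y := fun y hy => hu y (Multiset.mem_cons_of_mem hy)
    rw [Multiset.prod_cons, Multiset.map_cons, Multiset.sum_cons, Real.log_mul hx.ne' (Multiset.prod_pos hu').ne',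
      ih hu']

/-- In a multiset of reals `≥ 1`, each element is at most the product. -/
theorem le_multisetProd_of_mem {t : Multiset ℝ} (ht : ∀ R ∈ t, 1 ≤ R) {R : ℝ} (hR : R ∈ t) : R ≤ t.prod := by
  obtain ⟨u, rfl⟩ := Multiset.exists_cons_of_mem hR
  rw [Multiset.prod_cons]
  have hu : 1 ≤ u.prod := one_le_multiset_prod fun S hS => ht S (Multiset.mem_cons_of_mem hS)
  have h1 : 1 ≤ R := ht R (Multiset.mem_cons_self R u)
  nlinarith

/-- `∏ √x = √∏ x` over a multiset of nonnegative reals. -/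
theorem prod_map_sqrt (t : Multiset ℝ) (ht : ∀ x ∈ t, 0 ≤ x) : (t.map Real.sqrt).prod = Real.sqrt t.prod := by
  induction t using Multiset.induction_on with
  | empty => simp
  | cons x u ih =>
    have hx : 0 ≤ x := ht x (Multiset.mem_cons_self x u)
    have hu : ∀ y ∈ u, 0 ≤ y := fun y hy => ht y (Multiset.mem_cons_of_mem hy)
    rw [Multiset.map_cons, Multiset.prod_cons, Multiset.prod_cons, ih hu, Real.sqrt_mul hx]

/-- The slack of one root: `√(R + R⁻¹ - 2) = √R - (√R)⁻¹ = sinhTerm 1 (√R)` for `R ≥ 1`. -/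
theorem sqrt_add_inv_sub_two {R : ℝ} (hR : 1 ≤ R) : Real.sqrt (R + R⁻¹ - 2) = sinhTerm 1 (Real.sqrt R) := by
  unfold sinhTerm
  have hR0 : 0 < R := by linarith
  set x := Real.sqrt R with hx
  have hs : 0 < x := Real.sqrt_pos.mpr hR0
  have hs1 : 1 ≤ x := by rw [hx, ← Real.sqrt_one]; exact Real.sqrt_le_sqrt hR
  have hsq : x ^ 2 = R := Real.sq_sqrt hR0.le
  rw [pow_one]
  have key : R + R⁻¹ - 2 = (x - x⁻¹) ^ 2 := by
    rw [← hsq]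
    have hx0 : x ≠ 0 := hs.ne'
    field_simp
    ring
  rw [key, Real.sqrt_sq (by
    have : x⁻¹ ≤ 1 := inv_le_one_of_one_le₀ hs1
    linarith)]

/-- Superadditive summation: `Σ_{t} sinhTerm 1 x ≤ sinhTerm 1 (∏ x)` for `x ≥ 1`. -/
theorem sum_sinhTerm_le (t : Multiset ℝ) (ht : ∀ x ∈ t, 1 ≤ x) :
    (t.map fun x => sinhTerm 1 x).sum ≤ sinhTerm 1 t.prod := by
  induction t using Multiset.induction_on with
  | empty => simp [sinhTerm]
  | cons x u ih =>
    have hx : 1 ≤ x := ht x (Multiset.mem_cons_self x u)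
    have hu : ∀ y ∈ u, 1 ≤ y := fun y hy => ht y (Multiset.mem_cons_of_mem hy)
    have hu1 : 1 ≤ u.prod := one_le_multiset_prod hu
    rw [Multiset.map_cons, Multiset.sum_cons, Multiset.prod_cons]
    have h1 := sinhTerm_superadd 1 hx hu1
    have := ih hu
    linarith

/-! ## The cut -/

/-- **The explicit-auxiliary-function cut for a reciprocal root configuration.** -/
theorem auxCut_halfRoots (s : Multiset ℂ) (hs : ∀ α ∈ s, α ≠ 0) (a : List ℤ) (qs : List (List ℤ × ℚ))
    {B m₀ c : ℝ} (hc : 0 ≤ c) (he : ∀ j < qs.length, 0 ≤ (qs.getD j ([], 0)).2) (hH : AuxBound a qs B m₀ c)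
    (hB : (s.map fun α => ((X - C α) * (X - C α⁻¹) : ℂ[X])).prod.mahlerMeasure ≤ B)
    (hres : ∀ j < qs.length, 1 ≤ (s.map fun α => ‖qhat (qs.getD j ([], 0)).1 α‖).prod) :
    -(2 * (Multiset.card s : ℝ)) * m₀ - 2 * c * (Real.sqrt B - (Real.sqrt B)⁻¹) ≤
      ∑ k ∈ Finset.range a.length, ((a.getD k 0 : ℤ) : ℝ) * ((s.map fun α => α ^ (k + 1) + α⁻¹ ^ (k + 1)).sum).re := by
  set P := (s.map fun α => ((X - C α) * (X - C α⁻¹) : ℂ[X])).prod with hP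
  have hmonic : P.Monic := by
    rw [hP]; apply monic_multiset_prod_of_monic; intro α _
    exact (monic_X_sub_C _).mul (monic_X_sub_C _)
  have hM1 : 1 ≤ P.mahlerMeasure := by
    apply one_le_mahlerMeasure_of_one_le_norm_leadingCoeff
    rw [hmonic.leadingCoeff, norm_one]
  -- `R_α = max(‖α‖, ‖α‖⁻¹) = exp |log ‖α‖|`, product `M`
  have hRα : ∀ α ∈ s, max ‖α‖ ‖α‖⁻¹ = Real.exp |Real.log ‖α‖| := by
    intro α hα
    have hr : 0 < ‖α‖ := norm_pos_iff.mpr (hs α hα)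
    rcases le_or_gt 1 ‖α‖ with h1 | h1
    · rw [max_eq_left ((inv_le_one_of_one_le₀ h1).trans h1), abs_of_nonneg (Real.log_nonneg h1), Real.exp_log hr]
    · rw [max_eq_right (h1.le.trans (one_le_inv_iff₀.mpr ⟨hr, h1.le⟩)), abs_of_neg (Real.log_neg hr h1),
        Real.exp_neg, Real.exp_log hr]
  have hR1 : ∀ R ∈ (s.map fun α => max ‖α‖ ‖α‖⁻¹), 1 ≤ R := by
    intro R hR
    obtain ⟨α, hα, rfl⟩ := Multiset.mem_map.mp hR
    rcases le_or_gt 1 ‖α‖ with h | h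
    · exact le_max_of_le_left h
    · exact le_max_of_le_right (one_le_inv_iff₀.mpr ⟨norm_pos_iff.mpr (hs α hα), h.le⟩)
  have hR0 : ∀ R ∈ (s.map fun α => max ‖α‖ ‖α‖⁻¹), 0 ≤ R := fun R hR => zero_le_one.trans (hR1 R hR)
  have hMprod : (s.map fun α => max ‖α‖ ‖α‖⁻¹).prod = P.mahlerMeasure := by
    rw [hP, mahlerMeasure_halfRoots s hs, exp_multiset_sum, Multiset.map_map]
    congr 1; exact Multiset.map_congr rfl hRα
  -- the slack: `Σ_α √(u_α - 2) ≤ √M - 1/√M ≤ √B - 1/√B`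
  have hslack : (s.map fun α => Real.sqrt (max ‖α‖ ‖α‖⁻¹ + (max ‖α‖ ‖α‖⁻¹)⁻¹ - 2)).sum ≤
      Real.sqrt B - (Real.sqrt B)⁻¹ := by
    have h1 : (s.map fun α => Real.sqrt (max ‖α‖ ‖α‖⁻¹ + (max ‖α‖ ‖α‖⁻¹)⁻¹ - 2)) =
        (s.map fun α => Real.sqrt (max ‖α‖ ‖α‖⁻¹)).map fun x => sinhTerm 1 x := by
      rw [Multiset.map_map]
      exact Multiset.map_congr rfl fun α hα => sqrt_add_inv_sub_two (hR1 _ (Multiset.mem_map.mpr ⟨α, hα, rfl⟩))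
    have hsq1 : ∀ x ∈ (s.map fun α => Real.sqrt (max ‖α‖ ‖α‖⁻¹)), 1 ≤ x := by
      intro x hx
      obtain ⟨α, hα, rfl⟩ := Multiset.mem_map.mp hx
      rw [← Real.sqrt_one]; exact Real.sqrt_le_sqrt (hR1 _ (Multiset.mem_map.mpr ⟨α, hα, rfl⟩))
    rw [h1]
    refine (sum_sinhTerm_le _ hsq1).trans ?_
    have hprod : (s.map fun α => Real.sqrt (max ‖α‖ ‖α‖⁻¹)).prod = Real.sqrt P.mahlerMeasure := by
      rw [← hMprod, ← prod_map_sqrt _ hR0, Multiset.map_map]; rfl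
    rw [hprod, show Real.sqrt B - (Real.sqrt B)⁻¹ = sinhTerm 1 (Real.sqrt B) by simp [sinhTerm]]
    have hM1' : 1 ≤ Real.sqrt P.mahlerMeasure := by rw [← Real.sqrt_one]; exact Real.sqrt_le_sqrt hM1
    exact sinhTerm_mono 1 hM1' (Real.sqrt_le_sqrt hB)
  -- (H) at each half-root
  have hone : ∀ α ∈ s, -m₀ - c * Real.sqrt (max ‖α‖ ‖α‖⁻¹ + (max ‖α‖ ‖α‖⁻¹)⁻¹ - 2) ≤ auxF a qs α := by
    intro α hα
    have hα0 := hs α hα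
    have hr : 0 < ‖α‖ := norm_pos_iff.mpr hα0
    have hRle : max ‖α‖ ‖α‖⁻¹ ≤ B := by
      refine le_trans ?_ (hMprod ▸ hB)
      exact le_multisetProd_of_mem hR1 (Multiset.mem_map.mpr ⟨α, hα, rfl⟩)
    have hnz : ∀ j < qs.length, qhat (qs.getD j ([], 0)).1 α ≠ 0 := by
      intro j hj h0
      have : (s.map fun α => ‖qhat (qs.getD j ([], 0)).1 α‖).prod = 0 :=
        Multiset.prod_eq_zero (Multiset.mem_map.mpr ⟨α, hα, by rw [h0, norm_zero]⟩)
      have h1 := hres j hj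
      rw [this] at h1
      exact absurd h1 (by norm_num)
    rcases le_or_gt 1 ‖α‖ with h1 | h1
    · rw [max_eq_left ((inv_le_one_of_one_le₀ h1).trans h1)] at hRle ⊢
      exact hH α h1 hRle hnz
    · have hinv1 : 1 ≤ ‖α⁻¹‖ := by rw [norm_inv]; exact one_le_inv_iff₀.mpr ⟨hr, h1.le⟩
      rw [max_eq_right (h1.le.trans (by rwa [norm_inv] at hinv1))] at hRle ⊢
      have := hH α⁻¹ hinv1 (by rwa [norm_inv]) (fun j hj => by rw [qhat_inv]; exact hnz j hj)
      rw [norm_inv, inv_inv, auxF_inv] at this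
      rwa [inv_inv]
  have hsum := Multiset.sum_map_le_sum_map _ _ hone
  -- left side
  rw [Multiset.sum_map_sub, Multiset.map_const', Multiset.sum_replicate, Multiset.sum_map_mul_left] at hsum
  simp only [nsmul_eq_mul] at hsum
  have hleft : -(Multiset.card s : ℝ) * m₀ - c * (Real.sqrt B - (Real.sqrt B)⁻¹) ≤
      (Multiset.card s : ℝ) * (-m₀) - c * (s.map fun α => Real.sqrt (max ‖α‖ ‖α‖⁻¹ + (max ‖α‖ ‖α‖⁻¹)⁻¹ - 2)).sum := by
    nlinarith
  -- right side: `Σ_α F(α) = ½ Σ_k a_k Re s_k - Σ_j e_j log ∏ ‖q̂_j‖ ≤ ½ Σ_k a_k Re s_k`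
  have hA : (s.map fun α => ∑ k ∈ Finset.range a.length,
      ((a.getD k 0 : ℤ) : ℝ) * ((α ^ (k + 1) + α⁻¹ ^ (k + 1)).re / 2)).sum =
      ∑ k ∈ Finset.range a.length, ((a.getD k 0 : ℤ) : ℝ) * (((s.map fun α => α ^ (k + 1) + α⁻¹ ^ (k + 1)).sum).re / 2) := by
    rw [multiset_sum_finset_sum]
    apply Finset.sum_congr rfl
    intro k _
    rw [Multiset.sum_map_mul_left]
    congr 1
    have h := map_multiset_sum Complex.reAddGroupHom (s.map fun α => α ^ (k + 1) + α⁻¹ ^ (k + 1))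
    rw [Multiset.map_map] at h
    change ((s.map fun α => α ^ (k + 1) + α⁻¹ ^ (k + 1)).sum).re = (s.map fun α => (α ^ (k + 1) + α⁻¹ ^ (k + 1)).re).sum at h
    rw [h, Multiset.sum_map_div]
  have hL : 0 ≤ (s.map fun α => ∑ j ∈ Finset.range qs.length,
      (((qs.getD j ([], 0)).2 : ℚ) : ℝ) * Real.log ‖qhat (qs.getD j ([], 0)).1 α‖).sum := by
    rw [multiset_sum_finset_sum]
    apply Finset.sum_nonneg
    intro j hj
    rw [Finset.mem_range] at hj
    rw [Multiset.sum_map_mul_left]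
    apply mul_nonneg (by exact_mod_cast he j hj)
    have hpos : ∀ x ∈ (s.map fun α => ‖qhat (qs.getD j ([], 0)).1 α‖), 0 < x := by
      intro x hx
      obtain ⟨α, hα, rfl⟩ := Multiset.mem_map.mp hx
      rcases (norm_nonneg (qhat (qs.getD j ([], 0)).1 α)).eq_or_lt with h | h
      · exfalso
        have h0 : (s.map fun α => ‖qhat (qs.getD j ([], 0)).1 α‖).prod = 0 :=
          Multiset.prod_eq_zero (Multiset.mem_map.mpr ⟨α, hα, h.symm⟩)
        have h1 := hres j hj
        rw [h0] at h1; exact absurd h1 (by norm_num)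
      · exact h
    have := log_multiset_prod_eq_sum _ hpos
    rw [Multiset.map_map] at this
    change Real.log _ = (s.map fun α => Real.log ‖qhat (qs.getD j ([], 0)).1 α‖).sum at this
    rw [← this]
    exact Real.log_nonneg (hres j hj)
  have hF : (s.map fun α => auxF a qs α).sum ≤
      ∑ k ∈ Finset.range a.length, ((a.getD k 0 : ℤ) : ℝ) * (((s.map fun α => α ^ (k + 1) + α⁻¹ ^ (k + 1)).sum).re / 2) := by
    unfold auxF
    rw [Multiset.sum_map_sub, hA]
    linarith
  have h2 : ∑ k ∈ Finset.range a.length, ((a.getD k 0 : ℤ) : ℝ) * ((s.map fun α => α ^ (k + 1) + α⁻¹ ^ (k + 1)).sum).re =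
      2 * ∑ k ∈ Finset.range a.length, ((a.getD k 0 : ℤ) : ℝ) * (((s.map fun α => α ^ (k + 1) + α⁻¹ ^ (k + 1)).sum).re / 2) := by
    rw [Finset.mul_sum]
    apply Finset.sum_congr rfl
    intro k _; ring
  rw [h2]
  linarith

/-! ## Integer polynomials -/

/-- An auxiliary-function cut `([a_k,…,a_1], N)` at depth `k` is VALID for `(d, B)` if some family `(v_j, e_j)` (`e_j ≥ 0`,
`v_j` of length `≤ 2d` with a nonzero entry) and constants `m₀`, `c ≥ 0` satisfy (H) = `AuxBound` with
`2d·m₀ + 2c·(√B - 1/√B) < N + 1`. -/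
def CutValidA (d k : ℕ) (B : ℝ) (ct : List ℤ × ℤ) : Prop :=
  ct.1.length = k ∧ ∃ (qs : List (List ℤ × ℚ)) (m₀ c : ℝ), 0 ≤ c ∧ (∀ j < qs.length, 0 ≤ (qs.getD j ([], 0)).2) ∧
    (∀ j < qs.length, (qs.getD j ([], 0)).1.length ≤ 2 * d ∧ ∃ i, (qs.getD j ([], 0)).1.getD i 0 ≠ 0) ∧
    AuxBound ct.1.reverse qs B m₀ c ∧ 2 * (d : ℝ) * m₀ + 2 * c * (Real.sqrt B - (Real.sqrt B)⁻¹) < (ct.2 : ℝ) + 1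

/-- **The auxiliary-function cuts hold for small-measure IRREDUCIBLE palindromic polynomials**: for monic irreducible
palindromic `p ∈ ℤ[X]` of degree `2d` with `M(p) < B` and a valid cut `ct` of depth `k`: `0 ≤ N + Σ_j a_j P_j(p)`. -/
theorem acut_holds {p : ℤ[X]} {d : ℕ} (hmonic : p.Monic) (hirr : Irreducible p) (hdeg : p.natDegree = 2 * d)
    (hpal : ∀ j ≤ 2 * d, p.coeff j = p.coeff (2 * d - j)) {B : ℝ} (hB : intMahlerMeasure p < B) {k : ℕ}
    {ct : List ℤ × ℤ} (hc : CutValidA d k B ct) :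
    0 ≤ ct.2 + (List.zipWith (· * ·) ct.1 (psumsRev (descCoeffList p) k)).sum := by
  obtain ⟨hlen, qs, m₀, c, hc0, he, hqs, hH, hconst⟩ := hc
  obtain ⟨s', hcard, hs0, hP⟩ := palindromic_halfRoots_factorisation (p.map (Int.castRingHom ℂ)) d
    (hmonic.map _) (by rw [natDegree_map_eq_of_injective (Int.castRingHom ℂ).injective_int, hdeg])
    (fun j hj => by rw [coeff_map, coeff_map, hpal j hj])
  have hB' : (s'.map fun α => ((X - C α) * (X - C α⁻¹) : ℂ[X])).prod.mahlerMeasure ≤ B := by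
    rw [← hP]; exact hB.le
  have hres : ∀ j < qs.length, 1 ≤ (s'.map fun α => ‖qhat (qs.getD j ([], 0)).1 α‖).prod := by
    intro j hj
    obtain ⟨hl, hnz⟩ := hqs j hj
    exact one_le_prod_norm_vEval_halfRoots hmonic hirr hP _ (by rw [hdeg]; exact hl) hnz
  have hcut := auxCut_halfRoots s' hs0 ct.1.reverse qs hc0 he hH hB' hres
  rw [hcard, List.length_reverse, hlen] at hcut
  have hre : ∀ j ∈ Finset.range k, ((s'.map fun α => α ^ (j + 1) + α⁻¹ ^ (j + 1)).sum).re =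
      (((psumsRev (descCoeffList p) (j + 1)).getD 0 0 : ℤ) : ℝ) := by
    intro j _
    rw [← roots_powerSum_eq, ← hP, ← rootPowerSum_def, rootPowerSum_eq_head hmonic (by omega), Complex.intCast_re]
  rw [Finset.sum_congr rfl (fun j hj => by rw [hre j hj])] at hcut
  rw [sum_zipWith_psumsRev ct.1 _ k]
  have hget : ∀ j < k, ct.1.reverse.getD j 0 = ct.1.getD (k - 1 - j) 0 := by
    intro j hj
    rw [List.getD_eq_getElem?_getD, List.getElem?_reverse (by omega), hlen, List.getD_eq_getElem?_getD]
  have hsum : (((∑ j ∈ Finset.range k, ct.1.getD (k - 1 - j) 0 * (psumsRev (descCoeffList p) (j + 1)).getD 0 0 : ℤ)) : ℝ)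
      = ∑ j ∈ Finset.range k, ((ct.1.reverse.getD j 0 : ℤ) : ℝ) * (((psumsRev (descCoeffList p) (j + 1)).getD 0 0 : ℤ) : ℝ) := by
    push_cast
    apply Finset.sum_congr rfl
    intro j hj
    rw [Finset.mem_range] at hj
    rw [hget j hj]
  have key : (-(ct.2 + 1) : ℝ) <
      ((∑ j ∈ Finset.range k, ct.1.getD (k - 1 - j) 0 * (psumsRev (descCoeffList p) (j + 1)).getD 0 0 : ℤ) : ℝ) := by
    rw [hsum]; linarith
  have key' : -(ct.2 + 1) < ∑ j ∈ Finset.range k, ct.1.getD (k - 1 - j) 0 * (psumsRev (descCoeffList p) (j + 1)).getD 0 0 := by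
    exact_mod_cast key
  omega

end Summit.Ventures.DiscreteObjects.Mahler
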